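import Mathlib.Analysis.Convex.Function
import Mathlib.Topology.MetricSpace.HausdorffDistance
import Mathlib.Analysis.Normed.Module.Basic
import Mathlib.Tactic.LinearCombination
import Mathlib.Tactic.Linarith
import HarnessLib

/-!
# Convexity of the distance to a convex set

In a real normed space the distance function `x ↦ infDist x R` to a nonempty convex set `R` is
convex (`convexOn_infDist`), hence convex along every line (`convexOn_infDist_line`) and satisfies
the midpoint estimate `infDist ((a + b)/2) R ≤ (infDist a R + infDist b R)/2`
(`infDist_midpoint_le`).

This is the shared home (librarian hoist, promote event 1141960, 2026-08-16) of the three lemmas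
first proved in `Literature/Geometry/Lorentzian/CausalityChronologyProofs.lean`
(`Literature.Geometry.Lorentzian.CornerSmoothing.convexOn_infDist` & co., corner smoothing of causal
curves) and re-proved verbatim in `Literature/Geometry/Riemannian/HamiltonMaximumPrincipleTools.lean`
(`HamiltonMP.convexOn_infDist`, Hamilton's maximum principle for systems) to avoid the causality
import chain. Statements and proofs are byte-identical to the originals; only the namespace
(`Literature.Analysis.Convex`, the directory) is new. The two original files are to keep their names
as deprecated aliases of these.

Mathlib (v4.32.0) has `convexOn_dist`, `convexOn_norm` and `Metric.infDist` but not the convexity of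
`infDist · R` (searched `convexOn_infDist`, `ConvexOn … infDist`).

## References

* R. T. Rockafellar, *Convex Analysis*, Princeton 1970, §4 (distance function of a convex set is
  convex) — standard; recorded as folklore.
-/

noncomputable section

open Set Metric

namespace Literature.Analysis.Convex

variable {F : Type*} [NormedAddCommGroup F] [NormedSpace ℝ F]

/-- The distance to a convex set is a convex function. [folklore] -/
theorem convexOn_infDist {R : Set F} (hR : Convex ℝ R) (hne : R.Nonempty) :
    ConvexOn ℝ univ (fun x ↦ infDist x R) := by
  refine ⟨convex_univ, fun x _ x' _ a b ha hb hab ↦ ?_⟩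
  simp only [smul_eq_mul]
  refine le_of_forall_pos_le_add fun η hη ↦ ?_
  obtain ⟨z, hz, hxz⟩ := (infDist_lt_iff hne).mp (lt_add_of_pos_right (infDist x R) hη)
  obtain ⟨z', hz', hxz'⟩ := (infDist_lt_iff hne).mp (lt_add_of_pos_right (infDist x' R) hη)
  have hmem : a • z + b • z' ∈ R := hR hz hz' ha hb hab
  calc infDist (a • x + b • x') R ≤ dist (a • x + b • x') (a • z + b • z') :=
        infDist_le_dist_of_mem hmem
    _ ≤ a * dist x z + b * dist x' z' := by
        rw [dist_eq_norm, dist_eq_norm, dist_eq_norm]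
        calc ‖a • x + b • x' - (a • z + b • z')‖ = ‖a • (x - z) + b • (x' - z')‖ := by
              congr 1; simp only [smul_sub]; abel
          _ ≤ ‖a • (x - z)‖ + ‖b • (x' - z')‖ := norm_add_le _ _
          _ = a * ‖x - z‖ + b * ‖x' - z'‖ := by
              rw [norm_smul, norm_smul, Real.norm_of_nonneg ha, Real.norm_of_nonneg hb]
    _ ≤ a * (infDist x R + η) + b * (infDist x' R + η) := by gcongr
    _ = a * infDist x R + b * infDist x' R + η := by
        have : (a + b) * η = η := by rw [hab, one_mul]
        linear_combination this

/-- The distance to a convex set along a line `s ↦ x₀ + s v` is a convex function of `s`.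
[folklore] -/
theorem convexOn_infDist_line {R : Set F} (hR : Convex ℝ R) (hne : R.Nonempty) (x₀ v : F) :
    ConvexOn ℝ univ (fun s : ℝ ↦ infDist (x₀ + s • v) R) := by
  refine ⟨convex_univ, fun s _ s' _ a b ha hb hab ↦ ?_⟩
  have key := (convexOn_infDist hR hne).2 (mem_univ (x₀ + s • v)) (mem_univ (x₀ + s' • v))
    ha hb hab
  have heq : a • (x₀ + s • v) + b • (x₀ + s' • v) = x₀ + (a • s + b • s') • v := by
    have h1 : a • (x₀ + s • v) + b • (x₀ + s' • v) = (a + b) • x₀ + (a * s + b * s') • v := by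
      simp only [smul_add, add_smul, smul_smul]; abel
    rw [h1, hab, one_smul, smul_eq_mul, smul_eq_mul]
  rw [heq] at key
  exact key

/-- Midpoint estimate: `infDist ((a + b)/2) R ≤ (infDist a R + infDist b R)/2` for convex `R`.
[folklore] -/
theorem infDist_midpoint_le {R : Set F} (hR : Convex ℝ R) (hne : R.Nonempty) (a b : F) :
    infDist ((1 / 2 : ℝ) • a + (1 / 2 : ℝ) • b) R ≤ (infDist a R + infDist b R) / 2 := by
  have := (convexOn_infDist hR hne).2 (mem_univ a) (mem_univ b) (by norm_num : (0 : ℝ) ≤ 1 / 2)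
    (by norm_num : (0 : ℝ) ≤ 1 / 2) (by norm_num)
  simp only [smul_eq_mul] at this
  linarith

end Literature.Analysis.Convex
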